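/-
Fleet lead `ym-wcr-19609-p1` (seat prover-ym-wcr-19609-p1-g2-0), route `WeakCouplingRates`, crux `BulkDominatesColdBoxW`
(stmt-QuantumFields-19609), line `dlr-chessboard` (v4), brick M2 of the census v3 (item evidence #12).
-/
import Summits.QuantumFields.YangMills.Theorems.WeakCouplingRatesColdBoxForestPoincare
import Summits.QuantumFields.YangMills.Theorems.WeakCouplingRatesColdBoxForestGauge

/-!
# Crux `BulkDominatesColdBoxW`, stubs L1a/L1b: the forest Poincaré ladder with a SMALL (not flat) exterior datum

Brick M2 of the census v3 of the line `dlr-chessboard` (item evidence #12): the twin, for an exterior datum all of whose links are within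
`r` of `1`, of ★19456's flat-wall Poincaré bound `ell_le_uniform` (`Theorems/WeakCouplingRatesColdBoxForestPoincare.lean`: cold wall
`V = 1` off the box, forest links `1`, all plaquettes `ℓ(V_p) ≤ M` ⇒ every link `ℓ(V_e) ≤ (12H²+2H+1)·M`).

Reduction to the flat case (no new induction).  For a length function `ℓ` that is ALSO conjugation invariant (`ℓ(xgx⁻¹) = ℓ g`; e.g.
`opDist1 ∘ ρ` for a unitary representation), inserting a group element into a word costs at most its length:
`ℓ(x g y) ≤ ℓ(x y) + ℓ g` (`ell_mul_mul_le_of_conj`).  Replace the exterior links of `V` by `1` (`coldExt` of the restriction of `V` to the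
box): every plaquette holonomy changes by inserting/deleting at most four exterior links, each of length `≤ r`, so the flattened
configuration has all plaquettes `≤ M + 4r` (`ell_hol_coldExt_restrict_le`), is `1` off the box and `1` on the forest; `ell_le_uniform`
then bounds its links — which are the box links of `V` — by `(12H²+2H+1)(M + 4r)`, and the exterior links of `V` are `≤ r ≤` the same
(`ell_le_uniform_of_exterior_le`).  In the line's bookkeeping (`r = r₀ ≈ 17β^{θ+δ−1/2}` from the crude-good gauge B4, `M = √(2β^{2ε−1})`
on the good event) this is the sup-norm link bound `m ≲ H²β^{ε−1/2}` feeding the cubic chart remainder, uniformly over crude-good data.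
No new definition; standard axioms.  NOT a claim about the mass gap.
-/

set_option autoImplicit false

noncomputable section

open Literature.Probability.LatticeModels (Site glueWith glueWith_apply_mem glueWith_apply_not_mem)
open Literature.MathematicalPhysics.QuantumLattice
open Literature.MathematicalPhysics.QuantumFieldTheory
open Literature.MathematicalPhysics.QuantumFieldTheory.AxialGauge

namespace Summit.QuantumFields.YangMills.Theorems.WeakCouplingRates

section PoincareDatum

variable {G : Type*} [Group G] {H : ℕ}
variable (ℓ : G → ℝ) (hℓ1 : ℓ 1 = 0) (hℓmul : ∀ x y, ℓ (x * y) ≤ ℓ x + ℓ y) (hℓinv : ∀ x, ℓ x⁻¹ = ℓ x)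
  (hℓconj : ∀ x g, ℓ (x * g * x⁻¹) = ℓ g)

include hℓmul hℓconj in
/-- **Insertion costs at most the length of the inserted element** (conjugation-invariant length): `ℓ(x g y) ≤ ℓ(x y) + ℓ g`. -/
theorem ell_mul_mul_le_of_conj (x g y : G) : ℓ (x * g * y) ≤ ℓ (x * y) + ℓ g := by
  have h : x * g * y = (x * g * x⁻¹) * (x * y) := by group
  rw [h]
  calc ℓ (x * g * x⁻¹ * (x * y)) ≤ ℓ (x * g * x⁻¹) + ℓ (x * y) := hℓmul _ _
    _ = ℓ (x * y) + ℓ g := by rw [hℓconj]; ring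

include hℓmul hℓinv hℓconj in
/-- **Four insertions**: for `δ_a, δ_b, δ_c, δ_d` of length `≤ r`,
`ℓ(δ_a a · δ_b b · (δ_c c)⁻¹ · (δ_d d)⁻¹) ≤ ℓ(a b c⁻¹ d⁻¹) + 4r`. -/
theorem ell_hol_perturb_le {a b c d δa δb δc δd : G} {r : ℝ}
    (ha : ℓ δa ≤ r) (hb : ℓ δb ≤ r) (hc : ℓ δc ≤ r) (hd : ℓ δd ≤ r) :
    ℓ (δa * a * (δb * b) * (δc * c)⁻¹ * (δd * d)⁻¹) ≤ ℓ (a * b * c⁻¹ * d⁻¹) + 4 * r := by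
  have e0 : δa * a * (δb * b) * (δc * c)⁻¹ * (δd * d)⁻¹ = δa * (a * δb * b * c⁻¹ * δc⁻¹ * d⁻¹ * δd⁻¹) := by group
  have h1 : ℓ (δa * (a * δb * b * c⁻¹ * δc⁻¹ * d⁻¹ * δd⁻¹)) ≤ ℓ δa + ℓ (a * δb * b * c⁻¹ * δc⁻¹ * d⁻¹ * δd⁻¹) := hℓmul _ _
  have h2 : ℓ (a * δb * b * c⁻¹ * δc⁻¹ * d⁻¹ * δd⁻¹) ≤ ℓ (a * b * c⁻¹ * δc⁻¹ * d⁻¹ * δd⁻¹) + ℓ δb := by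
    have := ell_mul_mul_le_of_conj ℓ hℓmul hℓconj a δb (b * c⁻¹ * δc⁻¹ * d⁻¹ * δd⁻¹)
    simp only [← mul_assoc] at this
    exact this
  have h3 : ℓ (a * b * c⁻¹ * δc⁻¹ * d⁻¹ * δd⁻¹) ≤ ℓ (a * b * c⁻¹ * d⁻¹ * δd⁻¹) + ℓ δc⁻¹ := by
    have := ell_mul_mul_le_of_conj ℓ hℓmul hℓconj (a * b * c⁻¹) δc⁻¹ (d⁻¹ * δd⁻¹)
    simp only [← mul_assoc] at this
    exact this
  have h4 : ℓ (a * b * c⁻¹ * d⁻¹ * δd⁻¹) ≤ ℓ (a * b * c⁻¹ * d⁻¹) + ℓ δd⁻¹ := by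
    have := ell_mul_mul_le_of_conj ℓ hℓmul hℓconj (a * b * c⁻¹ * d⁻¹) δd⁻¹ 1
    simp only [mul_one] at this
    exact this
  rw [hℓinv] at h3 h4
  rw [e0]
  linarith

variable (V : LGConfig 4 G) {r M : ℝ}
  (hout : ∀ e, e ∉ boxEdges 4 (2 * H + 1) → ℓ (V e) ≤ r)
  (hforest : ∀ x : Site 4, (∀ k : Fin 4, 1 ≤ x k ∧ x k + 1 ≤ 2 * (H : ℤ)) → V (x, 0) = 1)
  (hM : ∀ (x : Site 4) (i j : Fin 4), ℓ (plaquetteHolonomyZd V x i j) ≤ M)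

include hℓ1 hM in
/-- `0 ≤ M` (degenerate plaquette). -/
theorem poincareDatum_M_nonneg : 0 ≤ M := by
  have h := hM 0 0 0
  have : plaquetteHolonomyZd V 0 0 0 = 1 := by simp [plaquetteHolonomyZd]
  rw [this, hℓ1] at h; exact h

include hℓ1 hℓinv hout in
/-- The «defect» of a link under flattening the exterior: `ℓ((coldExt V|_Λ) e · (V e)⁻¹) ≤ r` (it is `1` on the box and `(V e)⁻¹`
off it), provided `0 ≤ r`. -/
theorem ell_coldExt_restrict_mul_inv_le (hr : 0 ≤ r) (e : Literature.MathematicalPhysics.QuantumLattice.ZdEdge 4) :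
    ℓ (coldExt (H := H) (fun e' : ↥(boxEdges 4 (2 * H + 1)) => V e'.1) e * (V e)⁻¹) ≤ r := by
  by_cases he : e ∈ boxEdges 4 (2 * H + 1)
  · rw [coldExt_apply_mem _ ⟨e, he⟩, mul_inv_cancel, hℓ1]; exact hr
  · rw [coldExt_apply_not_mem _ he, one_mul, hℓinv]; exact hout e he

include hℓ1 hℓmul hℓinv hℓconj hout hM in
/-- **Flattening the exterior moves every plaquette by at most `4r`**: the configuration `coldExt V|_Λ` (box links of `V`, exterior
links `1`) has all plaquette holonomies of length `≤ M + 4r`. -/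
theorem ell_hol_coldExt_restrict_le (hr : 0 ≤ r) (x : Site 4) (i j : Fin 4) :
    ℓ (plaquetteHolonomyZd (coldExt (H := H) (fun e' : ↥(boxEdges 4 (2 * H + 1)) => V e'.1)) x i j) ≤ M + 4 * r := by
  set W : LGConfig 4 G := coldExt (H := H) (fun e' : ↥(boxEdges 4 (2 * H + 1)) => V e'.1) with hW
  have key : ∀ e, W e = (W e * (V e)⁻¹) * V e := fun e => by group
  have hδ := ell_coldExt_restrict_mul_inv_le (H := H) ℓ hℓ1 hℓinv V hout hr
  have h := ell_hol_perturb_le ℓ hℓmul hℓinv hℓconj (a := V (x, i)) (b := V (x + Pi.single i 1, j))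
    (c := V (x + Pi.single j 1, i)) (d := V (x, j)) (hδ (x, i)) (hδ (x + Pi.single i 1, j)) (hδ (x + Pi.single j 1, i)) (hδ (x, j))
  have hhol : plaquetteHolonomyZd W x i j =
      W (x, i) * (V (x, i))⁻¹ * V (x, i) * (W (x + Pi.single i 1, j) * (V (x + Pi.single i 1, j))⁻¹ * V (x + Pi.single i 1, j)) *
        (W (x + Pi.single j 1, i) * (V (x + Pi.single j 1, i))⁻¹ * V (x + Pi.single j 1, i))⁻¹ *
          (W (x, j) * (V (x, j))⁻¹ * V (x, j))⁻¹ := by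
    simp only [plaquetteHolonomyZd, inv_mul_cancel_right]
  rw [hhol]
  exact h.trans (by have := hM x i j; simp only [plaquetteHolonomyZd] at this; linarith)

include hℓ1 hℓmul hℓinv hℓconj hout hforest hM in
/-- **Poincaré bound in the temporal-forest gauge with a small exterior.**  If `ℓ` is a conjugation-invariant length function, `V` has
exterior links of length `≤ r` (`r ≥ 0`), forest links `1`, and all plaquettes `≤ M`, then EVERY link satisfies
`ℓ(V_e) ≤ (12H² + 2H + 1)·(M + 4r)` (`H ≥ 1`).  Reduction to the flat theorem `ell_le_uniform` applied to the flattened configuration. -/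
theorem ell_le_uniform_of_exterior_le (hH : 1 ≤ H) (hr : 0 ≤ r) (e : Literature.MathematicalPhysics.QuantumLattice.ZdEdge 4) :
    ℓ (V e) ≤ (12 * (H : ℝ) ^ 2 + 2 * H + 1) * (M + 4 * r) := by
  have hM0 := poincareDatum_M_nonneg ℓ hℓ1 V hM
  set W : LGConfig 4 G := coldExt (H := H) (fun e' : ↥(boxEdges 4 (2 * H + 1)) => V e'.1) with hW
  have hWout : ∀ e', e' ∉ boxEdges 4 (2 * H + 1) → W e' = 1 := fun e' he' => coldExt_apply_not_mem _ he'
  have hWforest : ∀ x : Site 4, (∀ k : Fin 4, 1 ≤ x k ∧ x k + 1 ≤ 2 * (H : ℤ)) → W (x, 0) = 1 := by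
    intro x hx
    have hmem : (x, (0 : Fin 4)) ∈ boxEdges 4 (2 * H + 1) := by
      rw [mem_boxEdges_iff]
      exact ⟨fun k => by have := hx k; constructor <;> push_cast <;> omega, by have := hx 0; push_cast; omega⟩
    rw [hW, coldExt_apply_mem _ ⟨(x, 0), hmem⟩]
    exact hforest x hx
  have hWM : ∀ (x : Site 4) (i j : Fin 4), ℓ (plaquetteHolonomyZd W x i j) ≤ M + 4 * r :=
    ell_hol_coldExt_restrict_le ℓ hℓ1 hℓmul hℓinv hℓconj V hout hM hr
  by_cases he : e ∈ boxEdges 4 (2 * H + 1)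
  · have hWe : W e = V e := coldExt_apply_mem _ ⟨e, he⟩
    rw [← hWe]
    exact ell_le_uniform ℓ hℓ1 hℓmul hℓinv W hWout hWforest hWM hH e
  · have h1 : (1 : ℝ) ≤ 12 * (H : ℝ) ^ 2 + 2 * H + 1 := by
      have : (1 : ℝ) ≤ H := by exact_mod_cast hH
      nlinarith
    calc ℓ (V e) ≤ r := hout e he
      _ ≤ 1 * (M + 4 * r) := by linarith
      _ ≤ (12 * (H : ℝ) ^ 2 + 2 * H + 1) * (M + 4 * r) := by gcongr

end PoincareDatum

end Summit.QuantumFields.YangMills.Theorems.WeakCouplingRates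

end
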